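import Mathlib
import HarnessLib
import Summits.CriticalPhenomena.CardyFormulaZ2.Theses.CardySelfRefinement
import Literature.Analysis.Complex.HarmonicSchwarzReflection
import Literature.Analysis.Complex.DerivNeZeroOfHalfDisc
import Literature.Analysis.Complex.FlatBoundaryPoissonExpansion
import Literature.Probability.RandomPlanarGeometry.JordanBoundaryChart
import Literature.Probability.RandomPlanarGeometry.ChordalReversibility
import Literature.Probability.RandomPlanarGeometry.ConformalRectangle
import Literature.Probability.RandomPlanarGeometry.IsometryCovariance

/-!
# Crux `SymmetryUpgradeR` (stmt-CriticalPhenomena-17239), line `SketchIdeatorTwo` — helper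
# `exitRigidity_flatWallChart` for stub `stub_exitRigidity` (FL4): the boundary chart at a flat wall

Analytic input of the cross-ratio asymptotics of dent rectangles at a locally FLAT boundary point
(the flat-wall clause of the touch hypothesis of stub `stub_exitRigidity`): **the boundary
correspondence of a conformal chart `φ : ℍ → Ω` of a Jordan domain `Ω` is real-analytic with
non-vanishing derivative along a straight boundary segment.**

Let `Ω ∩ B(z, r) = {w ∈ B(z, r) | Im(ū (w − z)) > 0}` (`|u| = 1`: the open half-disc on the
left of the wall direction `u`), and let `(φ, g)` be a boundary chart of `Ω`
(`JordanDomain.exists_boundaryChart`, Pommerenke 1992 Thm. 2.6 / Cor. 2.7) based at a boundary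
point outside `B(z, r)`. Then (`exitRigidity_flatWallChart`):

* in the wall coordinate `ζ ↦ z + u ζ` the inverse chart `φ⁻¹` extends from the upper half-disc
  `{|ζ| < r, Im ζ > 0}` to a holomorphic function `G` on the whole disc `B(0, r)` — the Schwarz
  reflection principle under the hypothesis `Im φ⁻¹ → 0` at the wall (Ahlfors 1979 Ch. 4 §6.5
  Thm. 26; tree: `exists_differentiableOn_extension_of_tendsto_im`), the hypothesis being supplied by
  the boundary correspondence `φ⁻¹ → g(s) ∈ ℝ` at `∂Ω(s)`;
* `G` is real on the real diameter and there `G(τ) = g(s)` whenever `∂Ω(s) = z + τ u`;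
* `G′(0) ≠ 0` (a holomorphic map taking a half-disc strictly above its real centre value is
  conformal at the centre; tree: `deriv_ne_zero_of_im_lt`) and `G′(0)` is real.

Also recorded: the boundary correspondence `g` of any boundary chart is continuous off the base
point (`continuousOn_chart`, from the convergence `φ⁻¹ → g(t)` at `∂Ω(t)` alone); wall points
are boundary points (`wall_mem_frontier`) and, conversely, boundary points in `B(z, r)` are wall
points (`eq_wall_of_mem_frontier`); and the DENT PARAMETERS (`exists_dentParams`): near the
parameter `t'` of `z` the boundary loop runs monotonically along the wall, so for every small
`e > 0` there are parameters `s₂ < t' < s₃` with `∂Ω(s₂), ∂Ω(s₃) = z ∓ σ e u` (`σ = ±1` the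
orientation of the loop along the wall) and `∂Ω[s₂, s₃]` inside the closed `e`-ball about `z`.

References: L. V. Ahlfors, *Complex Analysis*, 3rd ed. (1979), Ch. 4 §6.5 Thm. 26 (reflection
principle); Ch. Pommerenke, *Boundary Behaviour of Conformal Maps* (1992), Thm. 2.6, Cor. 2.7, §3.1.
-/

noncomputable section

namespace Summit.CriticalPhenomena.CardyFormulaZ2.Theorems.SymmetryUpgradeR.SwallowingSkeleton

open MeasureTheory Filter Set Metric Topology Complex
open Literature.Probability.RandomPlanarGeometry Literature.Probability.LatticeModels
  Literature.Probability.Percolation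
open UpperHalfPlane (upperHalfPlaneSet)
open scoped ComplexConjugate

/-! ### Continuity of boundary correspondences -/

/-- **The boundary correspondence of a boundary chart is continuous off the base point.** If
`φ⁻¹ w → g t` as `w → ∂Ω(t)` inside `Ω`, for every parameter `t` in a set `S`, then `g` is
continuous on `S`: near `∂Ω(t₀)` the values of `φ⁻¹` are close to `g t₀`, and `g t` is a limit of
such values at points of `Ω` near `∂Ω(t)`, which is near `∂Ω(t₀)` for `t` near `t₀`. -/
theorem continuousOn_chart (Ω : JordanDomain) {φinv : ℂ → ℂ} {g : ℝ → ℝ} {S : Set ℝ}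
    (h2 : ∀ t ∈ S, Tendsto φinv (𝓝[Ω.carrier] (Ω.boundary t)) (𝓝 (g t : ℂ))) :
    ContinuousOn g S := by
  intro t₀ ht₀
  rw [ContinuousWithinAt, Metric.tendsto_nhdsWithin_nhds]
  intro ε hε
  -- `φ⁻¹` is `ε/2`-close to `g t₀` on `Ω ∩ B(∂Ω(t₀), δ')`
  have h0 := Metric.tendsto_nhdsWithin_nhds.1 (h2 t₀ ht₀) (ε / 2) (by linarith)
  obtain ⟨δ', hδ', hclose⟩ := h0
  -- `∂Ω(t)` is `δ'/2`-close to `∂Ω(t₀)` for `t` `δ`-close to `t₀`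
  obtain ⟨δ, hδ, hbd⟩ := Metric.continuous_iff.1 Ω.continuous_boundary t₀ (δ' / 2) (by linarith)
  refine ⟨δ, hδ, fun t ht hdist => ?_⟩
  -- a point of `Ω` near `∂Ω(t)` where `φ⁻¹` is near `g t`
  have hne : (𝓝[Ω.carrier] (Ω.boundary t)).NeBot := by
    rw [← mem_closure_iff_nhdsWithin_neBot]
    exact frontier_subset_closure (Ω.boundary_mem_frontier t)
  have hev : ∀ᶠ w in 𝓝[Ω.carrier] (Ω.boundary t),
      dist (φinv w) (g t) < ε / 2 ∧ dist w (Ω.boundary t) < δ' / 2 ∧ w ∈ Ω.carrier := by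
    refine ((Metric.tendsto_nhds.1 (h2 t ht)) (ε / 2) (by linarith)).and
      ((?_ : ∀ᶠ w in 𝓝[Ω.carrier] (Ω.boundary t), dist w (Ω.boundary t) < δ' / 2).and
        self_mem_nhdsWithin)
    exact (Metric.tendsto_nhds.1 tendsto_id (δ' / 2) (by linarith)).filter_mono
      nhdsWithin_le_nhds
  obtain ⟨w, hw1, hw2, hw3⟩ := hev.exists
  have hw4 : dist w (Ω.boundary t₀) < δ' :=
    calc dist w (Ω.boundary t₀) ≤ dist w (Ω.boundary t) + dist (Ω.boundary t) (Ω.boundary t₀) :=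
          dist_triangle _ _ _
      _ < δ' / 2 + δ' / 2 := add_lt_add hw2 (hbd t hdist)
      _ = δ' := by ring
  have hw5 : dist (φinv w) (g t₀) < ε / 2 := hclose hw3 hw4
  have key : dist (g t : ℂ) (g t₀) < ε :=
    calc dist (g t : ℂ) (g t₀) ≤ dist (g t : ℂ) (φinv w) + dist (φinv w) (g t₀) :=
          dist_triangle _ _ _
      _ < ε / 2 + ε / 2 := add_lt_add (by rwa [dist_comm]) hw5
      _ = ε := by ring
  rwa [Complex.dist_eq, ← Complex.ofReal_sub, Complex.norm_real, Real.norm_eq_abs,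
    ← Real.dist_eq] at key

/-! ### Wall points -/

section Wall

variable {Ω : JordanDomain} {z u : ℂ} {r : ℝ}

/-- In the wall coordinate, `Im(ū · (u ζ)) = Im ζ` for a unit vector `u`. -/
theorem im_conj_mul_mul (hu : ‖u‖ = 1) (ζ : ℂ) : (conj u * (u * ζ)).im = ζ.im := by
  rw [← mul_assoc, ← Complex.normSq_eq_conj_mul_self, Complex.normSq_eq_norm_sq, hu]
  simp

/-- Points `z + u ζ` of the upper half-disc in the wall coordinate lie in `Ω`. -/
theorem wall_mem_carrier (hu : ‖u‖ = 1)
    (hflat : Ω.carrier ∩ ball z r = {w | w ∈ ball z r ∧ 0 < (conj u * (w - z)).im})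
    {ζ : ℂ} (hζ : ‖ζ‖ < r) (hζim : 0 < ζ.im) : z + u * ζ ∈ Ω.carrier := by
  have hmem : z + u * ζ ∈ {w | w ∈ ball z r ∧ 0 < (conj u * (w - z)).im} := by
    refine ⟨?_, ?_⟩
    · rw [mem_ball, dist_eq_norm, add_sub_cancel_left, norm_mul, hu, one_mul]
      exact hζ
    · show 0 < (conj u * (z + u * ζ - z)).im
      rw [add_sub_cancel_left, im_conj_mul_mul hu]
      exact hζim
  rw [← hflat] at hmem
  exact hmem.1

/-- **Wall points are boundary points**: for real `τ` with `|τ| < r`, `z + u τ ∈ ∂Ω` (it is not in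
`Ω`, and it is the limit of the interior points `z + u(τ + it)`, `t ↓ 0`). -/
theorem wall_mem_frontier (hu : ‖u‖ = 1)
    (hflat : Ω.carrier ∩ ball z r = {w | w ∈ ball z r ∧ 0 < (conj u * (w - z)).im})
    {τ : ℝ} (hτ : |τ| < r) : z + u * τ ∈ frontier Ω.carrier := by
  rw [frontier, Ω.isOpen.interior_eq]
  refine ⟨?_, ?_⟩
  · rw [Metric.mem_closure_iff]
    intro ε hε
    set t : ℝ := min (ε / 2) ((r - |τ|) / 2) with ht
    have htpos : 0 < t := lt_min (by linarith) (by linarith)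
    refine ⟨z + u * ((τ : ℂ) + (t : ℂ) * I), wall_mem_carrier hu hflat ?_ ?_, ?_⟩
    · calc ‖(τ : ℂ) + (t : ℂ) * I‖ ≤ ‖(τ : ℂ)‖ + ‖(t : ℂ) * I‖ := norm_add_le _ _
        _ = |τ| + t := by
          rw [norm_mul, Complex.norm_I, mul_one, Complex.norm_real, Complex.norm_real,
            Real.norm_eq_abs, Real.norm_eq_abs, abs_of_pos htpos]
        _ < r := by have := min_le_right (ε / 2) ((r - |τ|) / 2); linarith
    · simp [htpos]
    · rw [dist_eq_norm]
      have : z + u * (τ : ℂ) - (z + u * ((τ : ℂ) + (t : ℂ) * I)) = -(u * ((t : ℂ) * I)) := by ring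
      rw [this, norm_neg, norm_mul, hu, one_mul, norm_mul, Complex.norm_I, mul_one,
        Complex.norm_real, Real.norm_eq_abs, abs_of_pos htpos]
      have := min_le_left (ε / 2) ((r - |τ|) / 2)
      linarith
  · intro hmem
    have h' : z + u * (τ : ℂ) ∈ Ω.carrier ∩ ball z r := by
      refine ⟨hmem, ?_⟩
      rw [mem_ball, dist_eq_norm, add_sub_cancel_left, norm_mul, hu, one_mul, Complex.norm_real,
        Real.norm_eq_abs]
      exact hτ
    rw [hflat] at h'
    have := h'.2
    rw [add_sub_cancel_left, im_conj_mul_mul hu, Complex.ofReal_im] at this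
    exact lt_irrefl _ this

/-- Wall points lie in the ball `B(z, r)`. -/
theorem wall_mem_ball (hu : ‖u‖ = 1) {τ : ℝ} (hτ : |τ| < r) : z + u * τ ∈ ball z r := by
  rw [mem_ball, dist_eq_norm, add_sub_cancel_left, norm_mul, hu, one_mul, Complex.norm_real,
    Real.norm_eq_abs]
  exact hτ

/-- Every wall point is `∂Ω(s)` for some parameter `s`. -/
theorem exists_param_wall (hu : ‖u‖ = 1)
    (hflat : Ω.carrier ∩ ball z r = {w | w ∈ ball z r ∧ 0 < (conj u * (w - z)).im})
    {τ : ℝ} (hτ : |τ| < r) : ∃ s : ℝ, Ω.boundary s = z + u * τ := by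
  have h := wall_mem_frontier hu hflat hτ
  rw [← Ω.range_boundary] at h
  exact h

end Wall

/-! ### The flat-wall boundary chart -/

/-- Registered helper `exitRigidity_flatWallChart` (for stub `stub_exitRigidity`, line
`SketchIdeatorTwo` of crux stmt-CriticalPhenomena-17239). **Boundary chart at a flat wall.** Let
the Jordan domain `Ω` coincide in `B(z, r)` with the half-disc `{w | Im(ū (w − z)) > 0}`
(`|u| = 1`), and let `t₁` be a parameter with `∂Ω(t₁) ∉ B(z, r)`. There are a conformal chart
`φ : ℍ → Ω` and a real boundary correspondence `g` (boundary value `∂Ω(t)` at `g t`,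
`φ⁻¹ → g t` at `∂Ω(t)`, `g` separating boundary points, all off the base point `∂Ω(t₁)`;
Pommerenke 1992 Thm. 2.6 / Cor. 2.7 via `JordanDomain.exists_boundaryChart`) together with a
function `G`, holomorphic on the disc `B(0, r)` of the wall coordinate `ζ ↦ z + u ζ`, which is the
inverse chart `φ⁻¹(z + u ζ)` on the upper half-disc (Schwarz reflection under `Im φ⁻¹ → 0`,
Ahlfors 1979 Ch. 4 §6.5 Thm. 26), is real on the real diameter where it interpolates the boundary
correspondence (`G τ = g s` when `∂Ω(s) = z + u τ`), and has real non-zero derivative at `0`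
(conformality at a flat boundary point). -/
theorem exitRigidity_flatWallChart : ∀ (Ω : JordanDomain) (z u : ℂ) (r t₁ : ℝ), ‖u‖ = 1 → 0 < r → Ω.carrier ∩ Metric.ball z r = {w | w ∈ Metric.ball z r ∧ 0 < ((starRingEnd ℂ) u * (w - z)).im} → Ω.boundary t₁ ∉ Metric.ball z r → ∃ (φ : ConformalEquiv upperHalfPlaneSet Ω.carrier) (g : ℝ → ℝ) (G : ℂ → ℂ), (∀ t, Ω.boundary t ≠ Ω.boundary t₁ → φ.HasBoundaryValue (g t) (Ω.boundary t)) ∧ (∀ t, Ω.boundary t ≠ Ω.boundary t₁ → Tendsto φ.symm (nhdsWithin (Ω.boundary t) Ω.carrier) (nhds (g t))) ∧ (∀ s t, Ω.boundary s ≠ Ω.boundary t₁ → Ω.boundary t ≠ Ω.boundary t₁ → g s = g t → Ω.boundary s = Ω.boundary t) ∧ DifferentiableOn ℂ G (Metric.ball 0 r) ∧ (∀ ζ ∈ Metric.ball (0 : ℂ) r, 0 < ζ.im → G ζ = φ.symm (z + u * ζ)) ∧ (∀ τ : ℝ, |τ| < r → (G τ).im = 0) ∧ (∀ τ s : ℝ,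 |τ| < r → Ω.boundary s = z + u * τ → G τ = g s) ∧ deriv G 0 ≠ 0 ∧ (deriv G 0).im = 0 := by
  intro Ω z u r t₁ hu hr hflat ht₁
  obtain ⟨φ, g, h1, h2, h3, -, -, -⟩ := Ω.exists_boundaryChart t₁
  -- wall points are boundary points other than the base point
  have hwall_ne : ∀ τ : ℝ, |τ| < r → z + u * τ ≠ Ω.boundary t₁ := fun τ hτ h =>
    ht₁ (h ▸ wall_mem_ball hu hτ)
  -- the inverse chart in the wall coordinate
  set U : Set ℂ := ball (0 : ℂ) r with hU
  set f : ℂ → ℂ := fun ζ => φ.symm (z + u * ζ) with hf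
  have hUsymm : ∀ ζ ∈ U, conj ζ ∈ U := fun ζ hζ => by
    rw [hU, mem_ball_zero_iff] at hζ ⊢
    rwa [Complex.norm_conj]
  have hA : ∀ ζ ∈ U, 0 < ζ.im → z + u * ζ ∈ Ω.carrier := fun ζ hζ hζim =>
    wall_mem_carrier hu hflat (mem_ball_zero_iff.1 hζ) hζim
  have hAmaps : MapsTo (fun ζ => z + u * ζ) (U ∩ {ζ | 0 < ζ.im}) Ω.carrier :=
    fun ζ hζ => hA ζ hζ.1 hζ.2
  have hfd : DifferentiableOn ℂ f (U ∩ {ζ | 0 < ζ.im}) :=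
    φ.symm.differentiableOn.comp (by fun_prop) hAmaps
  -- the boundary correspondence at a wall point, in the wall coordinate
  have hlimf : ∀ (τ s : ℝ), |τ| < r → Ω.boundary s = z + u * τ →
      Tendsto f (𝓝[U ∩ {ζ | 0 < ζ.im}] (τ : ℂ)) (𝓝 (g s : ℂ)) := by
    intro τ s hτ hs
    have hT : Tendsto (fun ζ => z + u * ζ) (𝓝[U ∩ {ζ | 0 < ζ.im}] (τ : ℂ))
        (𝓝[Ω.carrier] (z + u * τ)) :=
      (Continuous.continuousWithinAt (by fun_prop)).tendsto_nhdsWithin hAmaps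
    have h2' := h2 s (hs ▸ hwall_ne τ hτ)
    rw [hs] at h2'
    exact h2'.comp hT
  have hlim : ∀ x ∈ U, x.im = 0 → Tendsto (fun ζ => (f ζ).im) (𝓝[U ∩ {ζ | 0 < ζ.im}] x) (𝓝 0) := by
    intro x hx hxim
    have hxre : ((x.re : ℝ) : ℂ) = x := Complex.ext (by simp) (by simp [hxim])
    have hτ : |x.re| < r := by
      have : ‖x‖ < r := mem_ball_zero_iff.1 hx
      rwa [← hxre, Complex.norm_real, Real.norm_eq_abs] at this
    obtain ⟨s, hs⟩ := exists_param_wall hu hflat hτ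
    have h := (Complex.continuous_im.tendsto _).comp (hlimf x.re s hτ hs)
    rw [hxre, Complex.ofReal_im] at h
    exact h
  -- Schwarz reflection
  obtain ⟨G, hGd, hGeq, -, hGreal⟩ :=
    Literature.Analysis.Complex.exists_differentiableOn_extension_of_tendsto_im isOpen_ball hUsymm
      hfd hlim
  have hmemτ : ∀ τ : ℝ, |τ| < r → (τ : ℂ) ∈ U := fun τ hτ => by
    rw [hU, mem_ball_zero_iff, Complex.norm_real, Real.norm_eq_abs]
    exact hτ
  have hGreal' : ∀ τ : ℝ, |τ| < r → (G τ).im = 0 := fun τ hτ =>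
    hGreal τ (hmemτ τ hτ) (Complex.ofReal_im τ)
  -- `G` interpolates `g` on the diameter
  have hGg : ∀ τ s : ℝ, |τ| < r → Ω.boundary s = z + u * τ → G τ = g s := by
    intro τ s hτ hs
    haveI : (𝓝[U ∩ {ζ : ℂ | 0 < ζ.im}] (τ : ℂ)).NeBot :=
      Literature.Analysis.Complex.neBot_nhdsWithin_upper isOpen_ball (hmemτ τ hτ)
        (Complex.ofReal_im τ)
    have hc : Tendsto G (𝓝[U ∩ {ζ | 0 < ζ.im}] (τ : ℂ)) (𝓝 (G τ)) :=
      ((hGd.continuousOn.continuousAt (isOpen_ball.mem_nhds (hmemτ τ hτ))).tendsto).mono_left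
        nhdsWithin_le_nhds
    have hc' : Tendsto G (𝓝[U ∩ {ζ | 0 < ζ.im}] (τ : ℂ)) (𝓝 (g s : ℂ)) :=
      (hlimf τ s hτ hs).congr' (eventually_nhdsWithin_of_forall fun ζ hζ => (hGeq hζ).symm)
    exact tendsto_nhds_unique hc hc'
  have h0U : (0 : ℂ) ∈ U := mem_ball_self hr
  -- conformality at the wall point
  have hderiv : deriv G 0 ≠ 0 := by
    refine Literature.Analysis.Complex.deriv_ne_zero_of_im_lt 1
      (hGd.analyticAt (isOpen_ball.mem_nhds h0U)) hr fun ζ hζ hζim => ?_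
    have h0 : (G 0).im = 0 := by simpa using hGreal' 0 (by simpa using hr)
    rw [zero_add, one_mul, h0, hGeq ⟨mem_ball_zero_iff.2 hζ, hζim⟩]
    exact φ.symm_mapsTo (hA ζ (mem_ball_zero_iff.2 hζ) hζim)
  have hderiv_im : (deriv G 0).im = 0 := by
    have h := Literature.Analysis.Complex.im_mul_deriv_eq_zero (ν := 1) (x := 0)
      (hGd.differentiableAt (isOpen_ball.mem_nhds h0U)) hr fun τ hτ => by
        rw [zero_add, one_mul]; exact hGreal' τ hτ
    rwa [one_mul] at h
  exact ⟨φ, g, G, h1, h2, h3, hGd, fun ζ hζ hζim => hGeq ⟨hζ, hζim⟩, hGreal', hGg, hderiv,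
    hderiv_im⟩

/-! ### Boundary points near a flat wall lie on the wall -/

/-- **Near a flat wall the boundary is the wall**: a frontier point of `Ω` inside `B(z, r)` lies on
the diameter `Im(ū (w − z)) = 0` (above it is `Ω`, open; below it an open set missing `Ω`, hence
missing `closure Ω`), so `w = z + u τ` with `τ = Re(ū (w − z))`. -/
theorem eq_wall_of_mem_frontier {Ω : JordanDomain} {z u : ℂ} {r : ℝ} (hu : ‖u‖ = 1)
    (hflat : Ω.carrier ∩ ball z r = {w | w ∈ ball z r ∧ 0 < (conj u * (w - z)).im}) {w : ℂ}
    (hw : w ∈ frontier Ω.carrier) (hwr : w ∈ ball z r) :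
    (conj u * (w - z)).im = 0 ∧ w = z + u * ((conj u * (w - z)).re : ℝ) := by
  have him : (conj u * (w - z)).im = 0 := by
    rcases lt_trichotomy 0 (conj u * (w - z)).im with hpos | h0 | hneg
    · -- above the wall: a point of `Ω`, not of its frontier
      have hmem : w ∈ Ω.carrier ∩ ball z r := by rw [hflat]; exact ⟨hwr, hpos⟩
      rw [frontier, Ω.isOpen.interior_eq] at hw
      exact absurd hmem.1 hw.2
    · exact h0.symm
    · -- below the wall: an open neighbourhood missing `Ω`
      have hV : IsOpen (ball z r ∩ {w' : ℂ | (conj u * (w' - z)).im < 0}) :=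
        isOpen_ball.inter (isOpen_lt (by fun_prop) continuous_const)
      have hwV : w ∈ ball z r ∩ {w' : ℂ | (conj u * (w' - z)).im < 0} := ⟨hwr, hneg⟩
      have hcl : w ∈ closure Ω.carrier := frontier_subset_closure hw
      rw [_root_.mem_closure_iff] at hcl
      obtain ⟨w', ⟨hw'r, hw'neg⟩, hw'Ω⟩ := hcl _ hV hwV
      have : w' ∈ Ω.carrier ∩ ball z r := ⟨hw'Ω, hw'r⟩
      rw [hflat] at this
      exact absurd this.2 (not_lt.2 (le_of_lt hw'neg))
  refine ⟨him, ?_⟩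
  have hq : conj u * (w - z) = ((conj u * (w - z)).re : ℝ) :=
    Complex.ext (by simp) (by simp [him])
  have hu1 : u * conj u = 1 := by
    rw [Complex.mul_conj, Complex.normSq_eq_norm_sq, hu]; simp
  calc w = z + u * conj u * (w - z) := by rw [hu1]; ring
    _ = z + u * ((conj u * (w - z)).re : ℝ) := by rw [mul_assoc, ← hq]

/-! ### Dent parameters at a flat wall -/

/-- **Dent parameters.** Let `Ω` be flat near `z = ∂Ω(t')` as above, with `lo < t' < hi`,
`0 ≤ lo`, `hi < 1`. There are a sign `σ = ±1` (the orientation of the boundary loop along the wall),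
`δ > 0` with `lo < t' - δ`, `t' + δ < hi`, and `e₀ > 0` such that for every `0 < e < e₀` there are
parameters `t' - δ ≤ s₂ < t' < s₃ ≤ t' + δ` with `∂Ω(s₂) = z − σ e u`, `∂Ω(s₃) = z + σ e u`, and
`∂Ω[s₂, s₃]` inside the closed `e`-ball about `z` (the boundary loop near `t'` runs monotonically
along the wall: continuity, `eq_wall_of_mem_frontier`, injectivity, intermediate values). -/
theorem exists_dentParams {Ω : JordanDomain} {z u : ℂ} {r : ℝ} (hu : ‖u‖ = 1) (hr : 0 < r)
    (hflat : Ω.carrier ∩ ball z r = {w | w ∈ ball z r ∧ 0 < (conj u * (w - z)).im})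
    {t' lo hi : ℝ} (hlo : lo < t') (hhi : t' < hi) (hlo0 : 0 ≤ lo) (hhi1 : hi < 1)
    (hzt : Ω.boundary t' = z) :
    ∃ σ δ e₀ : ℝ, (σ = 1 ∨ σ = -1) ∧ 0 < δ ∧ lo < t' - δ ∧ t' + δ < hi ∧ 0 < e₀ ∧ e₀ < r ∧
      ∀ e ∈ Ioo 0 e₀, ∃ s₂ s₃ : ℝ, t' - δ ≤ s₂ ∧ s₂ < t' ∧ t' < s₃ ∧ s₃ ≤ t' + δ ∧
        Ω.boundary s₂ = z + u * ((-(σ * e) : ℝ) : ℂ) ∧ Ω.boundary s₃ = z + u * ((σ * e : ℝ) : ℂ) ∧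
        ∀ s ∈ Icc s₂ s₃, dist (Ω.boundary s) z ≤ e := by
  -- the boundary loop stays in `B(z, r)` near `t'`
  obtain ⟨δ₀, hδ₀, hball⟩ := Metric.continuous_iff.1 Ω.continuous_boundary t' r hr
  set δ : ℝ := min (δ₀ / 2) (min ((t' - lo) / 2) ((hi - t') / 2)) with hδdef
  have hδpos : 0 < δ := lt_min (by linarith) (lt_min (by linarith) (by linarith))
  have hδ₁ : δ ≤ δ₀ / 2 := min_le_left _ _
  have hδ₂ : δ ≤ (t' - lo) / 2 := (min_le_right _ _).trans (min_le_left _ _)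
  have hδ₃ : δ ≤ (hi - t') / 2 := (min_le_right _ _).trans (min_le_right _ _)
  set I : Set ℝ := Icc (t' - δ) (t' + δ) with hIdef
  -- on `I` the loop runs along the wall: `∂Ω(s) = z + u τ(s)`
  set τ : ℝ → ℝ := fun s => (conj u * (Ω.boundary s - z)).re with hτdef
  have hτc : Continuous τ := by
    simp only [hτdef]
    exact Complex.continuous_re.comp (continuous_const.mul (Ω.continuous_boundary.sub continuous_const))
  have hwall : ∀ s ∈ I, Ω.boundary s = z + u * (τ s : ℂ) := by
    intro s hs
    have hsr : Ω.boundary s ∈ ball z r := by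
      rw [← hzt]
      refine hball s ?_
      rw [Real.dist_eq, abs_lt]
      constructor <;> linarith [hs.1, hs.2]
    exact (eq_wall_of_mem_frontier hu hflat (Ω.boundary_mem_frontier s) hsr).2
  have hτt' : τ t' = 0 := by simp [hτdef, hzt]
  have hIsub : I ⊆ Ico (0 : ℝ) 1 := fun s hs => ⟨by linarith [hs.1], by linarith [hs.2]⟩
  have hτi : InjOn τ I := by
    intro s hs s' hs' h
    have hb : Ω.boundary s = Ω.boundary s' := by rw [hwall s hs, hwall s' hs', h]
    exact Ω.injOn_boundary (hIsub hs) (hIsub hs') hb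
  have hle : t' - δ ≤ t' + δ := by linarith
  have hmono : StrictMonoOn τ I ∨ StrictAntiOn τ I :=
    hτc.continuousOn.strictMonoOn_of_injOn_Icc' hle hτi
  -- orient the wall coordinate so that it increases with the parameter
  obtain ⟨σ, hσ, hσmono⟩ : ∃ σ : ℝ, (σ = 1 ∨ σ = -1) ∧ StrictMonoOn (fun s => σ * τ s) I := by
    rcases hmono with h | h
    · exact ⟨1, Or.inl rfl, by simpa using h⟩
    · exact ⟨-1, Or.inr rfl, fun s hs s' hs' hss' => by simpa using h hs hs' hss'⟩
  have hσ2 : σ * σ = 1 := by rcases hσ with rfl | rfl <;> norm_num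
  have hσabs : |σ| = 1 := by rcases hσ with rfl | rfl <;> norm_num
  set τ' : ℝ → ℝ := fun s => σ * τ s with hτ'def
  have hτ'c : Continuous τ' := continuous_const.mul hτc
  have hττ' : ∀ s, τ s = σ * τ' s := fun s => by
    simp only [hτ'def]; rw [← mul_assoc, hσ2, one_mul]
  have hτ't' : τ' t' = 0 := by simp [hτ'def, hτt']
  have hmemL : t' - δ ∈ I := ⟨le_rfl, hle⟩
  have hmemR : t' + δ ∈ I := ⟨hle, le_rfl⟩
  have hmemM : t' ∈ I := ⟨by linarith, by linarith⟩
  have hA : τ' (t' - δ) < 0 := by rw [← hτ't']; exact hσmono hmemL hmemM (by linarith)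
  have hB : 0 < τ' (t' + δ) := by rw [← hτ't']; exact hσmono hmemM hmemR (by linarith)
  -- the size bound `e₀`
  set e₀ : ℝ := min (min (-τ' (t' - δ)) (τ' (t' + δ))) (r / 2) with he₀def
  have he₀pos : 0 < e₀ := lt_min (lt_min (by linarith) hB) (by linarith)
  have he₀A : e₀ ≤ -τ' (t' - δ) := (min_le_left _ _).trans (min_le_left _ _)
  have he₀B : e₀ ≤ τ' (t' + δ) := (min_le_left _ _).trans (min_le_right _ _)
  have he₀r : e₀ < r := (min_le_right _ _).trans_lt (by linarith)
  refine ⟨σ, δ, e₀, hσ, hδpos, by linarith, by linarith, he₀pos, he₀r, fun e he => ?_⟩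
  -- intermediate values on each side of `t'`
  have hivL : -e ∈ τ' '' Icc (t' - δ) t' := by
    refine intermediate_value_Icc (by linarith) hτ'c.continuousOn ⟨?_, ?_⟩
    · linarith [he.2]
    · rw [hτ't']; linarith [he.1]
  have hivR : e ∈ τ' '' Icc t' (t' + δ) := by
    refine intermediate_value_Icc (by linarith) hτ'c.continuousOn ⟨?_, ?_⟩
    · rw [hτ't']; linarith [he.1]
    · linarith [he.2]
  obtain ⟨s₂, hs₂, hs₂e⟩ := hivL
  obtain ⟨s₃, hs₃, hs₃e⟩ := hivR
  have hs₂I : s₂ ∈ I := ⟨hs₂.1, by linarith [hs₂.2]⟩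
  have hs₃I : s₃ ∈ I := ⟨by linarith [hs₃.1], hs₃.2⟩
  have hs₂lt : s₂ < t' := lt_of_le_of_ne hs₂.2 fun h => by
    rw [h, hτ't'] at hs₂e; linarith [he.1]
  have hs₃gt : t' < s₃ := lt_of_le_of_ne hs₃.1 fun h => by
    rw [← h, hτ't'] at hs₃e; linarith [he.1]
  refine ⟨s₂, s₃, hs₂.1, hs₂lt, hs₃gt, hs₃.2, ?_, ?_, fun s hs => ?_⟩
  · rw [hwall s₂ hs₂I, hττ' s₂, hs₂e, mul_neg]
  · rw [hwall s₃ hs₃I, hττ' s₃, hs₃e]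
  · have hsI : s ∈ I := ⟨hs₂I.1.trans hs.1, hs.2.trans hs₃I.2⟩
    have h1 : τ' s₂ ≤ τ' s := hσmono.monotoneOn hs₂I hsI hs.1
    have h2 : τ' s ≤ τ' s₃ := hσmono.monotoneOn hsI hs₃I hs.2
    rw [hwall s hsI, dist_eq_norm, add_sub_cancel_left, norm_mul, hu, one_mul, Complex.norm_real,
      Real.norm_eq_abs, hττ' s, abs_mul, hσabs, one_mul, abs_le]
    constructor <;> linarith

end Summit.CriticalPhenomena.CardyFormulaZ2.Theorems.SymmetryUpgradeR.SwallowingSkeleton
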